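import Mathlib
import Summits.Ventures.PercRepro2.Defs
import Summits.Ventures.PercRepro2.Harris
import Summits.Ventures.PercRepro2.FourFunctions

/-!
# The product-measure three-event inequality `(F₀)` (blind cell PercRepro2, p4 g10;
proofs/P4-G10-YBF.md §7)

For a product measure on the cube `Config E`, up-sets `O`, `B`, `X` (with the down-set `X̄ = Xᶜ`):

  **`(F₀)`**  `P(X̄)·P(O)·P(B) ≤ 2·P(X̄)·P(X ∩ O ∩ B) + P(X̄ ∩ O)·P(X̄ ∩ B)`,

i.e. `Φ(P) ≥ P(X̄)·Φ(P(· | X̄))` with `Φ(q) = 2q(O ∩ B) − q(O)q(B)`: the "positive-association excess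
with a factor 2" of the product measure dominates the `X̄`-fraction of the same quantity under the
measure conditioned on the DOWN-set `X̄` (which is not positively associated in general).

Proof (`f0_product`): `P(O)P(B) = P(X O)P(B) + P(X̄ O)P(X B) + P(X̄ O)P(X̄ B)`; Harris gives
`P(X O)P(B) ≤ P(X O B)`; the four functions theorem (`prob_mul_prob_le_of_sup_inf`) with
`ω ∈ X̄ ∩ O`, `ω' ∈ X ∩ B` ⟹ `ω ⊔ ω' ∈ X ∩ O ∩ B`, `ω ⊓ ω' ∈ X̄` gives `P(X̄ O)P(X B) ≤ P(X O B)P(X̄)`;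
hence `P(O)P(B) ≤ (1 + P(X̄))·P(X O B) + P(X̄ O)P(X̄ B)`, and multiplying by `P(X̄) ≤ 1` gives `(F₀)`
(`P(X̄)(1 + P(X̄)) ≤ 2`).

WHY IT MATTERS (S3 (G4-u), item (v)): the open inequality `(F)` of RootLeafUYBF.lean is EXACTLY `(F₀)`
for the cluster-conditioned measure `P(· | u ↮ a₂, u ↮ c)` with `O = {u ↔ o}`, `B = {u ↔ b}`,
`X = {a₂ ↔ c}` — the BHK-type lift of `(F₀)` (as BHK06 Thm 1.3 is the lift of Harris). The two steps
above do NOT lift termwise (both fail on the two-path gadget, where `(F)` is an equality): the lift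
needs a global argument.
-/

namespace Summit.Ventures.PercRepro2

namespace F0

variable {E : Type*} [Fintype E] [DecidableEq E] {R : Type*} [Field R] [LinearOrder R]
  [IsStrictOrderedRing R]

/-- **Harris for `X ∩ O` against `B`**: `P(X ∩ O)·P(B) ≤ P(X ∩ O ∩ B)`. -/
lemma prob_XO_mul_prob_B_le {p : E → R} (hp : IsProbVec p) {O B X : Set (Config E)}
    (hO : IsUpperSet O) (hB : IsUpperSet B) (hX : IsUpperSet X) :
    prob p (X ∩ O) * prob p B ≤ prob p (X ∩ O ∩ B) :=
  prob_mul_prob_le_prob_inter hp (hX.inter hO) hB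

/-- **The four-functions step**: `P(X̄ ∩ O)·P(X ∩ B) ≤ P(X ∩ O ∩ B)·P(X̄)` — for `ω ∈ X̄ ∩ O` and
`ω' ∈ X ∩ B` the join lies in `X ∩ O ∩ B` and the meet in `X̄`. -/
lemma prob_XbarO_mul_prob_XB_le {p : E → R} (hp : IsProbVec p) {O B X : Set (Config E)}
    (hO : IsUpperSet O) (hB : IsUpperSet B) (hX : IsUpperSet X) :
    prob p (Xᶜ ∩ O) * prob p (X ∩ B) ≤ prob p (X ∩ O ∩ B) * prob p Xᶜ := by
  refine prob_mul_prob_le_of_sup_inf hp fun ω hω ω' hω' => ?_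
  refine ⟨⟨⟨hX le_sup_right hω'.1, hO le_sup_left hω.2⟩, hB le_sup_right hω'.2⟩, ?_⟩
  exact hX.compl inf_le_left hω.1

/-- **`(F₀)`**: for a product measure and up-sets `O`, `B`, `X`,
`P(Xᶜ)·P(O)·P(B) ≤ 2·P(Xᶜ)·P(X ∩ O ∩ B) + P(Xᶜ ∩ O)·P(Xᶜ ∩ B)`. -/
theorem f0_product {p : E → R} (hp : IsProbVec p) {O B X : Set (Config E)}
    (hO : IsUpperSet O) (hB : IsUpperSet B) (hX : IsUpperSet X) :
    prob p Xᶜ * prob p O * prob p B ≤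
      2 * prob p Xᶜ * prob p (X ∩ O ∩ B) + prob p (Xᶜ ∩ O) * prob p (Xᶜ ∩ B) := by
  have hsO : prob p (X ∩ O) + prob p (Xᶜ ∩ O) = prob p O := by
    have h := prob_inter_add_prob_inter_compl p O X
    rw [Set.inter_comm O X, Set.inter_comm O Xᶜ] at h
    exact h
  have hsB : prob p (X ∩ B) + prob p (Xᶜ ∩ B) = prob p B := by
    have h := prob_inter_add_prob_inter_compl p B X
    rw [Set.inter_comm B X, Set.inter_comm B Xᶜ] at h
    exact h
  have h1 := prob_XO_mul_prob_B_le hp hO hB hX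
  have h2 := prob_XbarO_mul_prob_XB_le hp hO hB hX
  have ha0 : 0 ≤ prob p Xᶜ := prob_nonneg hp _
  have ha1 : prob p Xᶜ ≤ 1 := prob_le_one hp _
  have hm : 0 ≤ prob p (X ∩ O ∩ B) := prob_nonneg hp _
  have ho1 : 0 ≤ prob p (Xᶜ ∩ O) := prob_nonneg hp _
  have hb1 : 0 ≤ prob p (Xᶜ ∩ B) := prob_nonneg hp _
  -- `P(O)P(B) = P(XO)P(B) + P(X̄O)P(XB) + P(X̄O)P(X̄B)`
  have e : prob p Xᶜ * prob p O * prob p B =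
      prob p Xᶜ * (prob p (X ∩ O) * prob p B) + prob p Xᶜ * (prob p (Xᶜ ∩ O) * prob p (X ∩ B)) +
        prob p Xᶜ * (prob p (Xᶜ ∩ O) * prob p (Xᶜ ∩ B)) := by
    rw [← hsO, ← hsB]
    ring
  have h1' : prob p Xᶜ * (prob p (X ∩ O) * prob p B) ≤ prob p Xᶜ * prob p (X ∩ O ∩ B) :=
    mul_le_mul_of_nonneg_left h1 ha0
  have h2' : prob p Xᶜ * (prob p (Xᶜ ∩ O) * prob p (X ∩ B)) ≤
      prob p Xᶜ * (prob p (X ∩ O ∩ B) * prob p Xᶜ) :=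
    mul_le_mul_of_nonneg_left h2 ha0
  have h3 : prob p Xᶜ * (prob p (X ∩ O ∩ B) * prob p Xᶜ) ≤ prob p Xᶜ * prob p (X ∩ O ∩ B) := by
    have : prob p Xᶜ * (prob p (X ∩ O ∩ B) * prob p Xᶜ) =
        (prob p Xᶜ * prob p (X ∩ O ∩ B)) * prob p Xᶜ := by ring
    rw [this]
    exact mul_le_of_le_one_right (mul_nonneg ha0 hm) ha1
  have h4 : prob p Xᶜ * (prob p (Xᶜ ∩ O) * prob p (Xᶜ ∩ B)) ≤
      prob p (Xᶜ ∩ O) * prob p (Xᶜ ∩ B) :=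
    mul_le_of_le_one_left (mul_nonneg ho1 hb1) ha1
  rw [e]
  linarith

/-- **`(F₀)` in the `Φ`-form**: `2·P(X̄)·P(O ∩ B) − P(X̄)·P(O)·P(B) ≥ 2·P(X̄)·P(X̄ ∩ O ∩ B) −
P(X̄ ∩ O)·P(X̄ ∩ B)`, i.e. `Φ(P) ≥ P(X̄)·Φ(P(· | X̄))` cleared by `P(X̄)`. -/
theorem f0_product_Phi {p : E → R} (hp : IsProbVec p) {O B X : Set (Config E)}
    (hO : IsUpperSet O) (hB : IsUpperSet B) (hX : IsUpperSet X) :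
    2 * prob p Xᶜ * prob p (Xᶜ ∩ (O ∩ B)) - prob p (Xᶜ ∩ O) * prob p (Xᶜ ∩ B) ≤
      2 * prob p Xᶜ * prob p (O ∩ B) - prob p Xᶜ * prob p O * prob p B := by
  have h := f0_product hp hO hB hX
  have hs : prob p (X ∩ (O ∩ B)) + prob p (Xᶜ ∩ (O ∩ B)) = prob p (O ∩ B) := by
    have h' := prob_inter_add_prob_inter_compl p (O ∩ B) X
    rw [Set.inter_comm (O ∩ B) X, Set.inter_comm (O ∩ B) Xᶜ] at h'
    exact h'
  have e : X ∩ O ∩ B = X ∩ (O ∩ B) := Set.inter_assoc _ _ _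
  rw [e] at h
  have ha0 : 0 ≤ prob p Xᶜ := prob_nonneg hp _
  nlinarith [h, hs, ha0]

end F0

end Summit.Ventures.PercRepro2
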